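import Mathlib
import Summits.NavierStokesRegularity.NavierStokesRegularity.Theorems.ThreadingFluxHorizonTowerFiniteTowerIsolationClass
import Summits.NavierStokesRegularity.NavierStokesRegularity.Theorems.ThreadingFluxHorizonTowerFiniteTowerZonality
import HarnessLib

/-!
# Crux `PoloidalLiouville` (stmt-NavierStokesRegularity-1222), crux idea «horizon-threading-tower» (ns-idea-15):
# FINITE TOWERS AT ORDER ONE — ★★ THM C: A THIRD ISOLATED SHELL OF THE OPPOSITE PARITY

Support file (`--supports stmt-NavierStokesRegularity-1222`, helper; cell `ns-wall-extremal`, width hand ns-wall-eng-3 g4; 0 kit).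

When the two largest degrees `D′ < D` of a finite tower have the SAME parity (always the case when they are not coprime), the largest
degree `a` of the OPPOSITE parity is automatically isolated against the top shell inside its (odd) parity class
(`finiteTower_chartT_detP_eq_zero_of_class`): every competing pair with `j + k ≥ a + D` consists of two degrees above `a`, hence of
the parity of `D`, hence of even sum.  So BOTH `f_{D′}^D ∝ g^{D′}` and `f_a^D ∝ g^a` hold for the null-cone charts, and every root
multiplicity of the top chart `g` is divisible by `D / gcd(D, D′)` and by `D / gcd(D, a)`; if `gcd(D, D′, a) = 1` it is divisible by `D`,
`g = β q^D` with `deg q ≤ 2`, the top shell is zonal and THM A finishes: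

* `exists_nsmul_eq_of_dvd_count`, `exists_monic_eq_C_mul_pow_of_two_rel` — root arithmetic with two pure-power relations;
* `exists_real_axis_of_chartT_eq_pow` — a real solid harmonic whose chart is `β q^D` (`deg q ≤ 2`) is zonal about a real axis;
* ★★ `finiteTower_zonal_of_oppositeParity` (THM C): `D′ ≡ D (mod 2)`, `a` = the largest degree of `K` of the other parity,
  `H_D, H_{D′}, H_a ≢ 0`, `Nat.Coprime D (Nat.gcd D′ a)` ⇒ the tower is coaxially zonal.  Covers e.g. `{1,2,4,6}`, `{1,3,4,8}`, `{3,4,6}`;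
  contains ARM A's even–even dipole towers `{1, m, n}` (`a = 1`) and complements THM B (coprime top pair) and THM D (three shells).

HONEST LABEL: special cases of the crux-idea conjecture `HorizonTowerZonality` (order one; side condition on three shells); towers whose
degrees are all of one parity with non-coprime top pair (`{2,4,6}`, `{1,3,9}`), general towers, `PoloidalLiouville` (1222) OPEN;
W1 movement 0; NS regularity NOT proved.  [folklore]
-/

-- the summit and its single sub-problem share the name (CONVENTIONS §1)
set_option linter.dupNamespace false

noncomputable section

open MvPolynomial Complex
open scoped Polynomial RealInnerProductSpace
open Literature.Analysis.FluidPDE (cross)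

namespace Summit.NavierStokesRegularity.NavierStokesRegularity.Theorems.PoloidalLiouville.HorizonTower

/-! ### Root arithmetic with two pure-power relations -/

/-- A multiset all of whose multiplicities are divisible by `D` is `D • M` for some multiset `M`. [folklore] -/
theorem Zonal.exists_nsmul_eq_of_dvd_count {s : Multiset ℂ} {D : ℕ} (h : ∀ a, D ∣ s.count a) :
    ∃ M : Multiset ℂ, D • M = s := by
  classical
  refine ⟨∑ a ∈ s.toFinset, (s.count a / D) • ({a} : Multiset ℂ), ?_⟩
  ext b
  rw [Multiset.count_nsmul, Multiset.count_sum']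
  simp only [Multiset.count_nsmul, Multiset.count_singleton, mul_ite, mul_one, mul_zero]
  rw [Finset.sum_ite_eq s.toFinset b]
  by_cases hb : b ∈ s.toFinset
  · rw [if_pos hb, Nat.mul_div_cancel' (h b)]
  · rw [if_neg hb, mul_zero]
    exact (Multiset.count_eq_zero.mpr (fun hm => hb (Multiset.mem_toFinset.mpr hm))).symm

/-- **Two pure-power relations with jointly coprime exponents force a common `D`-th power**: `f₁^D = c₁ g^{b₁}`, `f₂^D = c₂ g^{b₂}`,
`f₁, f₂ ≠ 0`, `gcd(D, b₁, b₂) = 1` ⇒ `g = lc(g) · q^D` with `q` monic and `D · deg q = deg g`. [folklore] -/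
theorem Zonal.exists_monic_eq_C_mul_pow_of_two_rel {f₁ f₂ g : ℂ[X]} {D b₁ b₂ : ℕ} (hD : 1 ≤ D) (hf₁ : f₁ ≠ 0) (hf₂ : f₂ ≠ 0)
    {c₁ c₂ : ℂ} (h₁ : f₁ ^ D = Polynomial.C c₁ * g ^ b₁) (h₂ : f₂ ^ D = Polynomial.C c₂ * g ^ b₂)
    (hcop : Nat.Coprime D (Nat.gcd b₁ b₂)) :
    ∃ q : ℂ[X], q.Monic ∧ g = Polynomial.C g.leadingCoeff * q ^ D ∧ D * q.natDegree = g.natDegree := by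
  classical
  have hD0 : D ≠ 0 := by omega
  have hc₁ : c₁ ≠ 0 := by
    rintro rfl; rw [Polynomial.C_0, zero_mul] at h₁; exact hf₁ ((pow_eq_zero_iff hD0).mp h₁)
  have hc₂ : c₂ ≠ 0 := by
    rintro rfl; rw [Polynomial.C_0, zero_mul] at h₂; exact hf₂ ((pow_eq_zero_iff hD0).mp h₂)
  have hcount : ∀ ζ, D ∣ g.roots.count ζ := by
    intro ζ
    have e₁ := Zonal.count_roots_of_pow_eq hc₁ h₁ ζ
    have e₂ := Zonal.count_roots_of_pow_eq hc₂ h₂ ζ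
    have d₁ : D ∣ b₁ * g.roots.count ζ := ⟨f₁.roots.count ζ, by rw [← e₁]⟩
    have d₂ : D ∣ b₂ * g.roots.count ζ := ⟨f₂.roots.count ζ, by rw [← e₂]⟩
    have d : D ∣ Nat.gcd (b₁ * g.roots.count ζ) (b₂ * g.roots.count ζ) := Nat.dvd_gcd d₁ d₂
    rw [Nat.gcd_mul_right] at d
    exact hcop.dvd_of_dvd_mul_left d
  obtain ⟨M, hM⟩ := Zonal.exists_nsmul_eq_of_dvd_count hcount
  refine ⟨(M.map (Polynomial.X - Polynomial.C ·)).prod, Polynomial.monic_multisetProd_X_sub_C M, ?_, ?_⟩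
  · have hsplit := (IsAlgClosed.splits g).eq_prod_roots
    rw [← hM, Multiset.map_nsmul, Multiset.prod_nsmul] at hsplit
    exact hsplit
  · rw [Polynomial.natDegree_multiset_prod_X_sub_C_eq_card, ← Multiset.card_nsmul, hM]
    exact (IsAlgClosed.splits g).natDegree_eq_card_roots.symm

/-- **A real solid harmonic whose chart is a `D`-th power of a quadratic is zonal about a real axis.** [folklore] -/
theorem Zonal.exists_real_axis_of_chartT_eq_pow {H : MvPolynomial (Fin 3) ℝ} {D : ℕ} (hH : H.IsHomogeneous D) (hD : 1 ≤ D)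
    (hlap : Zonal.lapP H = 0) {q : ℂ[X]} (hq0 : q ≠ 0) (hq2 : q.natDegree ≤ 2) {β : ℂ}
    (hchart : Zonal.chartT (map (algebraMap ℝ ℂ) H) = Polynomial.C β * q ^ D) :
    ∃ n : Fin 3 → ℝ, n ≠ 0 ∧ Zonal.detP (C (n 0) * X 0 + C (n 1) * X 1 + C (n 2) * X 2) H = 0 := by
  obtain ⟨a, ha⟩ := Zonal.exists_lin_chartT_eq hq2
  have ha0 : a ≠ 0 := by
    rintro rfl
    have : q = 0 := by rw [← ha]; simp
    exact hq0 this
  have hchart' : Zonal.chartT (map (algebraMap ℝ ℂ) H)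
      = Polynomial.C β * Zonal.chartT (C (a 0) * X 0 + C (a 1) * X 1 + C (a 2) * X 2) ^ D := by rw [ha]; exact hchart
  have hrot := Zonal.detP_lin_eq_zero_of_chartT_eq (hH.map (algebraMap ℝ ℂ)) hD
    (by rw [← Zonal.map_lapP, hlap, map_zero]) a hchart'
  exact Zonal.exists_real_axis_of_detP_lin_eq_zero ha0 hrot

/-! ### ★★ THM C -/

section ThirdShell

variable (K : Finset ℕ) (H : ℕ → E3 → ℝ)

/-- **THM C, polynomial level.**  `D = max K`, `D′` the second largest degree with `D′ ≡ D (mod 2)`, `a ∈ K` the largest degree of the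
other parity; `P_D, P_{D′}, P_a ≠ 0`; `Nat.Coprime D (Nat.gcd D′ a)` ⇒ the top shell is annihilated by the rotation derivative about
some real axis. [folklore] -/
theorem finiteTower_exists_axis_of_oppositeParity (hK : ∀ l ∈ K, 1 ≤ l) (hH : ∀ l ∈ K, ContDiff ℝ (⊤ : ℕ∞) (H l))
    (hhom : ∀ l ∈ K, ∀ (c : ℝ) (y : E3), H l (c • y) = c ^ l * H l y)
    (hharm : ∀ l ∈ K, ∀ y, Laplacian.laplacian (H l) y = 0)
    (hL1 : ∀ x : E3, x ≠ 0 → horizonL1 (fun z => ∑ l ∈ K, horizonProfile l (H l) 0 z) 0 x = 0)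
    (P : ℕ → MvPolynomial (Fin 3) ℝ)
    (hP : ∀ l ∈ K, (P l).IsHomogeneous l ∧ Zonal.lapP (P l) = 0 ∧ ∀ y, H l y = Zonal.evalE (P l) y)
    {D D' a : ℕ} (hD : D ∈ K) (hD' : D' ∈ K) (hlt : D' < D) (hmax : ∀ l ∈ K, l ≤ D) (hsec : ∀ l ∈ K, l ≠ D → l ≤ D')
    (hpar : D' % 2 = D % 2) (haK : a ∈ K) (hapar : a % 2 ≠ D % 2) (hamax : ∀ l ∈ K, l % 2 ≠ D % 2 → l ≤ a)
    (hcop : Nat.Coprime D (Nat.gcd D' a)) (hPD : P D ≠ 0) (hPD' : P D' ≠ 0) (hPa : P a ≠ 0) :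
    ∃ n : Fin 3 → ℝ, n ≠ 0 ∧ Zonal.detP (C (n 0) * X 0 + C (n 1) * X 1 + C (n 2) * X 2) (P D) = 0 := by
  have haD : a ≠ D := fun h => hapar (by rw [h])
  have halt : a < D := lt_of_le_of_ne (hmax a haK) haD
  -- `(a, D)` is isolated inside its parity class
  have hiso := finiteTower_chartT_detP_eq_zero_of_class K H hK hH hhom hharm hL1 P (fun l hl => (hP l hl).2.2) haK hD haD (by
    intro j hj k hk hjk hsum hcls h1 h2
    exfalso
    have hjD := hmax j hj
    have hkD := hmax k hk
    rcases eq_or_ne k D with rfl | hkne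
    · -- `(j, D)`: `j ≥ a`, `j` of the parity of `a` ⇒ `j = a`
      have hja : j % 2 ≠ k % 2 := by intro h; apply hapar; omega
      have := hamax j hj hja
      exact h1 ⟨by omega, rfl⟩
    · rcases eq_or_ne j D with rfl | hjne
      · have hka : k % 2 ≠ j % 2 := by intro h; apply hapar; omega
        have := hamax k hk hka
        exact h2 ⟨rfl, by omega⟩
      · -- both below `D`: both above `a`, hence both of the parity of `D`, sum of the wrong parity
        have hk' := hsec k hk hkne
        have hj' := hsec j hj hjne
        have hja : a < j := by omega
        have hka : a < k := by omega
        have hjp : j % 2 = D % 2 := by by_contra h; exact absurd (hamax j hj h) (by omega)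
        have hkp : k % 2 = D % 2 := by by_contra h; exact absurd (hamax k hk h) (by omega)
        omega)
  -- charts
  set fa : ℂ[X] := Zonal.chartT (map (algebraMap ℝ ℂ) (P a)) with hfa
  set fD' : ℂ[X] := Zonal.chartT (map (algebraMap ℝ ℂ) (P D')) with hfD'
  set g : ℂ[X] := Zonal.chartT (map (algebraMap ℝ ℂ) (P D)) with hg
  have hfa0 : fa ≠ 0 := fun h => hPa (Zonal.eq_zero_of_chartT_map_eq_zero (hP a haK).1 (hP a haK).2.1 h)
  have hfD'0 : fD' ≠ 0 := fun h => hPD' (Zonal.eq_zero_of_chartT_map_eq_zero (hP D' hD').1 (hP D' hD').2.1 h)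
  have hg0 : g ≠ 0 := fun h => hPD (Zonal.eq_zero_of_chartT_map_eq_zero (hP D hD).1 (hP D hD).2.1 h)
  -- the weighted Wronskian laws `a·fa·g′ = D·g·fa′` and `D′·fD′·g′ = D·g·fD′′`
  have hWa : (a : ℂ[X]) * fa * Polynomial.derivative g = (D : ℂ[X]) * g * Polynomial.derivative fa := by
    have h := Zonal.chartT_detP (((hP a haK).1).map (algebraMap ℝ ℂ)) (((hP D hD).1).map (algebraMap ℝ ℂ))
    rw [← Zonal.map_detP, hiso, mul_zero] at h
    exact sub_eq_zero.mp h.symm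
  have hWD' := finiteTower_top_wronskian K H hK hH hhom hharm hL1 P (fun l hl => ⟨(hP l hl).1, (hP l hl).2.2⟩) hD hD' hlt
    hmax hsec
  obtain ⟨c₁, hc₁⟩ := Zonal.exists_C_mul_of_wronskian_eq_zero (pow_ne_zero _ hg0)
    (Zonal.wronskian_pow_pow_eq_zero (hK a haK) (hK D hD) hWa)
  obtain ⟨c₂, hc₂⟩ := Zonal.exists_C_mul_of_wronskian_eq_zero (pow_ne_zero _ hg0)
    (Zonal.wronskian_pow_pow_eq_zero (hK D' hD') (hK D hD) hWD')
  obtain ⟨q, hqm, hgq, hdeg⟩ := Zonal.exists_monic_eq_C_mul_pow_of_two_rel (hK D hD) hfD'0 hfa0 hc₂ hc₁ hcop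
  have hq2 : q.natDegree ≤ 2 := by
    have h1 : g.natDegree ≤ 2 * D := Zonal.natDegree_chartT_le (((hP D hD).1).map (algebraMap ℝ ℂ))
    have h2 : D * q.natDegree ≤ D * 2 := by rw [hdeg, mul_comm]; exact h1
    exact Nat.le_of_mul_le_mul_left h2 (hK D hD)
  exact Zonal.exists_real_axis_of_chartT_eq_pow (hP D hD).1 (hK D hD) (hP D hD).2.1 hqm.ne_zero hq2 hgq

/-- ★★ **THM C — OPPOSITE-PARITY THIRD SHELL.**  A finite scale-free tower of horizon profiles passing order one whose two largest
degrees `D′ < D` have the same parity, whose largest degree `a` of the opposite parity carries a non-zero shell (as do `D`, `D′`), and with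
`gcd(D, D′, a) = 1`, is COAXIALLY ZONAL. [folklore] -/
theorem finiteTower_zonal_of_oppositeParity (hK : ∀ l ∈ K, 1 ≤ l) (hH : ∀ l ∈ K, ContDiff ℝ (⊤ : ℕ∞) (H l))
    (hhom : ∀ l ∈ K, ∀ (c : ℝ) (y : E3), H l (c • y) = c ^ l * H l y)
    (hharm : ∀ l ∈ K, ∀ y, Laplacian.laplacian (H l) y = 0)
    (hL1 : ∀ x : E3, x ≠ 0 → horizonL1 (fun z => ∑ l ∈ K, horizonProfile l (H l) 0 z) 0 x = 0)
    {D D' a : ℕ} (hD : D ∈ K) (hD' : D' ∈ K) (hlt : D' < D) (hmax : ∀ l ∈ K, l ≤ D) (hsec : ∀ l ∈ K, l ≠ D → l ≤ D')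
    (hpar : D' % 2 = D % 2) (haK : a ∈ K) (hapar : a % 2 ≠ D % 2) (hamax : ∀ l ∈ K, l % 2 ≠ D % 2 → l ≤ a)
    (hcop : Nat.Coprime D (Nat.gcd D' a)) (hD0 : ∃ y, H D y ≠ 0) (hD'0 : ∃ y, H D' y ≠ 0) (ha0 : ∃ y, H a y ≠ 0) :
    ∃ b : E3, b ≠ 0 ∧ ∀ l ∈ K, ∀ y : E3, ⟪cross b y, gradient (H l) y⟫ = 0 := by
  obtain ⟨P, hP⟩ := finiteTower_exists_polys K H hH hhom hharm
  have hne : ∀ {l}, l ∈ K → (∃ y, H l y ≠ 0) → P l ≠ 0 := by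
    intro l hl ⟨y, hy⟩ h
    apply hy
    rw [(hP l hl).2.2 y, h]
    simp [Zonal.evalE]
  obtain ⟨n, hn, htop⟩ := finiteTower_exists_axis_of_oppositeParity K H hK hH hhom hharm hL1 P hP hD hD' hlt hmax hsec hpar haK
    hapar hamax hcop (hne hD hD0) (hne hD' hD'0) (hne haK ha0)
  have hna : (WithLp.toLp 2 n : E3) ≠ 0 := by
    intro h
    apply hn
    funext i
    have := congrArg (fun v : E3 => v i) h
    simpa using this
  refine ⟨WithLp.toLp 2 n, hna, fun l hl y => ?_⟩
  have h := finiteTower_detP_lin_eq_zero_of_top K H hK hH hhom hharm hL1 P hP hD hmax (hne hD hD0) hn htop l hl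
  rw [Zonal.detP_lin_eq_zero_iff] at h
  have := h y
  rwa [← show H l = Zonal.evalE (P l) from funext (hP l hl).2.2] at this

/-- THM C with the zonal functional forms. [folklore] -/
theorem finiteTower_zonalForm_of_oppositeParity (hK : ∀ l ∈ K, 1 ≤ l) (hH : ∀ l ∈ K, ContDiff ℝ (⊤ : ℕ∞) (H l))
    (hhom : ∀ l ∈ K, ∀ (c : ℝ) (y : E3), H l (c • y) = c ^ l * H l y)
    (hharm : ∀ l ∈ K, ∀ y, Laplacian.laplacian (H l) y = 0)
    (hL1 : ∀ x : E3, x ≠ 0 → horizonL1 (fun z => ∑ l ∈ K, horizonProfile l (H l) 0 z) 0 x = 0)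
    {D D' a : ℕ} (hD : D ∈ K) (hD' : D' ∈ K) (hlt : D' < D) (hmax : ∀ l ∈ K, l ≤ D) (hsec : ∀ l ∈ K, l ≠ D → l ≤ D')
    (hpar : D' % 2 = D % 2) (haK : a ∈ K) (hapar : a % 2 ≠ D % 2) (hamax : ∀ l ∈ K, l % 2 ≠ D % 2 → l ≤ a)
    (hcop : Nat.Coprime D (Nat.gcd D' a)) (hD0 : ∃ y, H D y ≠ 0) (hD'0 : ∃ y, H D' y ≠ 0) (ha0 : ∃ y, H a y ≠ 0) :
    ∃ b : E3, b ≠ 0 ∧ ∀ l ∈ K, ∃ g : ℝ → ℝ, ∀ y : E3, y ≠ 0 → H l y = ‖y‖ ^ l * g (⟪b, y⟫ / ‖y‖) := by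
  obtain ⟨b, hb, hrot⟩ := finiteTower_zonal_of_oppositeParity K H hK hH hhom hharm hL1 hD hD' hlt hmax hsec hpar haK hapar hamax hcop
    hD0 hD'0 ha0
  exact ⟨b, hb, fun l hl => exists_zonalForm_of_inner_cross_gradient_eq_zero (l := l) hb ((hH l hl).differentiable (by simp))
    (fun c y _ => hhom l hl c y) (hrot l hl)⟩

end ThirdShell

end Summit.NavierStokesRegularity.NavierStokesRegularity.Theorems.PoloidalLiouville.HorizonTower

end
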